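import Summits.ResolutionOfSingularities.ResolutionOfSingularities.Theorems.HilbertSamuelEliminationSigmaMaxModificationsCorridor3SigmaStrataLineages
import Summits.ResolutionOfSingularities.ResolutionOfSingularities.Theorems.HilbertSamuelEliminationSigmaMaxModificationsCorridor3WLadderStrataBirths
import HarnessLib

/-!
# [OURS · L1 W4.2] σ-LAYER — Ω-TRANSPORT brick 3a: the W-low STRATA KERNEL ROWS under an arbitrary strategy σ — (D)σ, (b-end)σ, (c-geo)σ,
# (c-rep)σ — the QNe reduction, the CYCLE RANGE of a marked stage, and the `Iff.rfl` dictionary back to stub-4's rows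

Crux chain w42 (`SigmaMaxModifications`, stmt-ResolutionOfSingularities-18506; conjunct `SigmaMaxModificationsCorridor3`,
stmt-ResolutionOfSingularities-19249), res-L1-w42-plan-1 RULING v3.14-12 (BR-6) / v3.14-14 (DL) «Ω-transports of the W-low rows — 040».
Typer res-type-040 (gen 18). σ-copies (oracle binder `∀ R, OracleFunctional R → OracleAdmissible R →` replaced by the strategy PARAMETER `σ`,
`CanonicalNearStep R`/`Reaches R`/`StepProjection R`/`IsBlownUp R`/`IsCanonicalStep R … (c m).L (c m).P` replaced by res-D-pv-047's / res-type-012's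
`CanonicalNearStepσ σ`/`Reachesσ σ`/`StepProjectionσ σ`/`IsBlownUpσ σ`/`σ.step (c m).W (c m).ln …`) of stub-4's kernel rows (D)
`MaxOriginMovingNondegenerate` (p504439), (b-end) `StrataCycleEndBirthsSettle` (p505133), (c-geo) `StrataLineageInCentreIO` and (c-rep)
`StrataReplayBlowupsSettle` (p503069); rows (b)σ/(c)σ are brick 1 (p526259). For `σ = Strategy.cjs R` each σ-row IS stub-4's row
(`…_iff_forall_cjs`, `Iff.rfl`). Plus the bookkeeping set `cycleRange N ν s` («what the current cycle has replayed so far»: the treated part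
between cycles, the replayed subscheme inside a cycle) used by brick 3b's lineage tracking along Ω⁺-cycles. OURS (cell res-hironaka, slot
W4.2); NOT statements of H. Hironaka's manuscript [Hironaka2017] nor of [CossartJannsenSaito2020]; AI-typed, weaker than expert review. The
four `def … : Prop` rows are OPEN obligations-as-binders exactly like their CJS originals (intended proofs: see the originals' docstrings);
every `theorem` here is PROVED. Helper file `--supports stmt-ResolutionOfSingularities-19249` (counted 0).

Contents (namespace `…Theorems.SigmaMaxModificationsCorridor3.Sigma`): `MaxOriginMovingNondegenerateσ`, `maxOriginNoMovingNearChainAtQσ_of_qNe`,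
`StrataCycleEndBirthsSettleσ`, `StrataReplayBlowupsSettleσ`, `StrataLineageInCentreIOσ`, `cycleRange` (+ `cycleRange_of_none` / `_of_some`),
dictionary `maxOriginMovingNondegenerate_iff_forall_cjs`, `strataCycleEndBirthsSettle_iff_forall_cjs`, `strataReplayBlowupsSettle_iff_forall_cjs`,
`strataLineageInCentreIO_iff_forall_cjs`. References: CJS LNM 2270 Rem. 6.29 (1), Thm. 6.35, Prop. 6.31 [CossartJannsenSaito2020]; tree
`…Corridor3SigmaStepDefs` (p519751), `…Corridor3SigmaIsoDefs` (p523704), `…WLadderStrataScope/Labels/Births` (p504439/p503069/p505133).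
-/

noncomputable section

set_option linter.dupNamespace false

open CategoryTheory AlgebraicGeometry TopologicalSpace Topology
open Summit.ResolutionOfSingularities.ResolutionOfSingularities.Theorems.CampaignW42
open Literature.AlgebraicGeometry.Resolution Literature.RingTheory.HilbertSamuel
open Summit.ResolutionOfSingularities.ResolutionOfSingularities.Theorems.SigmaMaxModificationsCorridor3
open Summit.ResolutionOfSingularities.ResolutionOfSingularities.Theorems.SigmaMaxModificationsCorridor3.Moving

namespace Summit.ResolutionOfSingularities.ResolutionOfSingularities.Theorems.SigmaMaxModificationsCorridor3.Sigma

universe u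

variable {σ : Strategy.{u}} {N : ℕ} {ν : ℕ → ℕ}

/-! ## §1. Row (D)σ and the QNe reduction -/

/-- [OURS · L1 W4.2] **ROW (D)σ — MOVING σ-CHAINS ARE NON-DEGENERATE**: along an infinite σ-chain from a maximal origin of characteristic
`p` at level `N` whose marked point is blown up infinitely often, `ν ≠ Φ^{(N)}` (σ-copy of stub-4's `MaxOriginMovingNondegenerate`).
OURS row; NOT a statement of the manuscript. [folklore] -/
def MaxOriginMovingNondegenerateσ (σ : Strategy.{u}) (p N : ℕ) : Prop :=
  ∀ (ν : ℕ → ℕ) (X : Scheme.{u}) [IsLocallyNoetherian X] (x : X), IsMaximalOrigin p N ν X x →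
  ∀ c : ℕ → MarkedStage.{u}, Reachesσ σ N ν (MarkedStage.init X x) (c 0) →
    (∀ n, CanonicalNearStepσ σ N ν (c n) (c (n + 1))) → (∀ n, ∃ m, n ≤ m ∧ (c m).IsBlownUpσ σ N ν) →
    ν ≠ iterPSum N Phi

/-- **Rows may be proved under `ν ≠ Φ^{(N)}`, σ form**: given (D)σ, a moving σ-row at `QNe Q` gives the moving σ-row at `Q`. [folklore] -/
theorem maxOriginNoMovingNearChainAtQσ_of_qNe {p N : ℕ} {Q : ℕ → (ℕ → ℕ) → ∀ X : Scheme.{u}, X → Prop}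
    {G : MarkedStage.{u} → Prop} (hD : MaxOriginMovingNondegenerateσ σ p N)
    (h : MaxOriginNoMovingNearChainAtQσ σ p N (QNe Q) G) : MaxOriginNoMovingNearChainAtQσ σ p N Q G := by
  intro ν X _ x hX hQ
  rintro ⟨c, h0, hstep, hG, hmov⟩
  exact h ν X x hX ⟨hQ, hD ν X x hX c h0 hstep hmov⟩ ⟨c, h0, hstep, hG, hmov⟩

/-! ## §2. Rows (b-end)σ, (c-rep)σ, (c-geo)σ -/

/-- [OURS · L1 W4.2] **ROW (b-end)σ — AT LATE BLOWN-UP CYCLE-END σ-STEPS NO COMPONENT THROUGH THE CHAIN POINT IS NEWBORN** (σ-copy of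
stub-4's `StrataCycleEndBirthsSettle`): along every moving, never-isolated `G`-chain of σ-steps from a `Q`-maximal origin, from some stage on,
whenever `x_n` is blown up (σ-sense) AND the next state is between cycles (`(c (n+1)).P = none`), every irreducible component of
`X_{n+1}(ν)` through `x_{n+1}` dominates a component of `X_n(ν)`. OURS row, OPEN as a binder; NOT a statement of the manuscript.
[cite: CossartJannsenSaito2020, Thm. 3.14, Rem. 6.29 (1)] -/
def StrataCycleEndBirthsSettleσ (σ : Strategy.{u}) (p N : ℕ) (Q : ℕ → (ℕ → ℕ) → ∀ X : Scheme.{u}, X → Prop)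
    (G : MarkedStage.{u} → Prop) : Prop :=
  ∀ (ν : ℕ → ℕ) (X : Scheme.{u}) [IsLocallyNoetherian X] (x : X), IsMaximalOrigin p N ν X x → Q N ν X x →
  ∀ c : ℕ → MarkedStage.{u}, Reachesσ σ N ν (MarkedStage.init X x) (c 0) →
    (∀ n, CanonicalNearStepσ σ N ν (c n) (c (n + 1))) → (∀ n, G (c n)) → (∀ n, ¬ Iso N (c n)) →
    (∀ n, ∃ m, n ≤ m ∧ (c m).IsBlownUpσ σ N ν) →
    ∃ n₁, ∀ n, n₁ ≤ n → (c n).IsBlownUpσ σ N ν → (c (n + 1)).P = none →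
      ∀ f : (c (n + 1)).W ⟶ (c n).W, StepProjectionσ σ N ν (c n) (c (n + 1)) f →
        ∀ Z' ∈ componentsThrough N ν (c (n + 1)), closure (f.base '' Z') ∈ componentsIn (Scheme.hsStratum (c n).W N ν)

/-- [OURS · L1 W4.2] **ROW (c-rep)σ — REPLAY BLOW-UPS OF THE CHAIN POINT SETTLE** (σ-copy of stub-4's `StrataReplayBlowupsSettle`): in the same
scope, from some stage on, whenever the marked point `x_n` is blown up (σ-sense) the next state is between cycles. OURS row, OPEN as a
binder; NOT a statement of the manuscript. [cite: CossartJannsenSaito2020, Rem. 6.29 (1), Prop. 6.31] -/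
def StrataReplayBlowupsSettleσ (σ : Strategy.{u}) (p N : ℕ) (Q : ℕ → (ℕ → ℕ) → ∀ X : Scheme.{u}, X → Prop)
    (G : MarkedStage.{u} → Prop) : Prop :=
  ∀ (ν : ℕ → ℕ) (X : Scheme.{u}) [IsLocallyNoetherian X] (x : X), IsMaximalOrigin p N ν X x → Q N ν X x →
  ∀ c : ℕ → MarkedStage.{u}, Reachesσ σ N ν (MarkedStage.init X x) (c 0) →
    (∀ n, CanonicalNearStepσ σ N ν (c n) (c (n + 1))) → (∀ n, G (c n)) → (∀ n, ¬ Iso N (c n)) →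
    (∀ n, ∃ m, n ≤ m ∧ (c m).IsBlownUpσ σ N ν) →
    ∃ n₁, ∀ n, n₁ ≤ n → (c n).IsBlownUpσ σ N ν → (c (n + 1)).P = none

/-- [OURS · L1 W4.2] **ROW (c-geo)σ — NO LINEAGE THROUGH THE CHAIN POINTS LIES IN THE CENTRE INFINITELY OFTEN** (σ-copy of stub-4's
`StrataLineageInCentreIO`): in the same scope there is no dominating lineage `Z_n ∋ x_n` of irreducible components of the `ν`-strata which,
for infinitely many `m`, lies inside the centre of a σ-step allowed at stage `m`. OURS row, OPEN as a binder; NOT a statement of the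
manuscript. [cite: CossartJannsenSaito2020, Rem. 6.29 (1), Thm. 3.6, Prop. 6.31] -/
def StrataLineageInCentreIOσ (σ : Strategy.{u}) (p N : ℕ) (Q : ℕ → (ℕ → ℕ) → ∀ X : Scheme.{u}, X → Prop)
    (G : MarkedStage.{u} → Prop) : Prop :=
  ∀ (ν : ℕ → ℕ) (X : Scheme.{u}) [IsLocallyNoetherian X] (x : X), IsMaximalOrigin p N ν X x → Q N ν X x →
  ∀ c : ℕ → MarkedStage.{u}, Reachesσ σ N ν (MarkedStage.init X x) (c 0) →
    (∀ n, CanonicalNearStepσ σ N ν (c n) (c (n + 1))) → (∀ n, G (c n)) → (∀ n, ¬ Iso N (c n)) →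
    (∀ n, ∃ m, n ≤ m ∧ (c m).IsBlownUpσ σ N ν) →
    ¬ ∃ Z : ∀ n, Set (c n).W, (∀ n, Z n ∈ componentsThrough N ν (c n)) ∧
        (∀ n, ∃ f : (c (n + 1)).W ⟶ (c n).W, StepProjectionσ σ N ν (c n) (c (n + 1)) f ∧
          closure (f.base '' Z (n + 1)) = Z n) ∧
        ∀ n, ∃ m, n ≤ m ∧ ∃ (C : (c m).W.IdealSheafData) (P' : Option (Pending (blowup C))),
          σ.step (c m).W (c m).ln N ν (c m).L (c m).P C P' ∧ Z m ⊆ (C.support : Set (c m).W)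

/-! ## §3. The cycle range of a marked stage -/

/-- [OURS · L1 W4.2] **THE CYCLE RANGE of a marked stage** — «what the current cycle has replayed so far, read on the stage»: BETWEEN
cycles the treated part `Y_n^{(j)}` (`j = treatedLabel`, the least non-empty label — the subscheme the next cycle embeds), INSIDE a cycle
the image `range φ` of the replayed subscheme. Along a CJS run the two agree with the label part (`CycleInv.pending`); along an Ω⁺-run
(`IsCanonicalStepΩplus`, whole regular components allowed as centres) only `cycleRange ⊆` part holds, and the END centre is
`V(cycleRange)`. OURS bookkeeping; NOT a statement of the manuscript. [cite: CossartJannsenSaito2020, Rem. 6.29 (1), (6.5)–(6.7)] -/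
def cycleRange (N : ℕ) (ν : ℕ → ℕ) (s : MarkedStage.{u}) : Set s.W :=
  s.P.elim (s.L.part (Scheme.hsStratum s.W N ν) (treatedLabel N ν s)) fun Q => Set.range Q.hom.base

/-- Unfolding, between cycles. [folklore] -/
theorem cycleRange_of_none {s : MarkedStage.{u}} (h : s.P = none) :
    cycleRange N ν s = s.L.part (Scheme.hsStratum s.W N ν) (treatedLabel N ν s) := by
  simp [cycleRange, h]

/-- Unfolding, inside a cycle. [folklore] -/
theorem cycleRange_of_some {s : MarkedStage.{u}} {Q : Pending s.W} (h : s.P = some Q) :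
    cycleRange N ν s = Set.range Q.hom.base := by
  simp [cycleRange, h]

/-- Between cycles a component of the treated label lies in the cycle range. [folklore] -/
theorem subset_cycleRange_of_none {s : MarkedStage.{u}} (h : s.P = none) {Z : Set s.W}
    (hZ : Z ∈ componentsIn (Scheme.hsStratum s.W N ν)) (hl : s.L.label Z = treatedLabel N ν s) : Z ⊆ cycleRange N ν s := by
  rw [cycleRange_of_none h]
  exact s.L.subset_part hZ hl

/-- Under the part invariant «replayed subscheme ⊆ label part» the cycle range lies in the treated part. [folklore] -/
theorem cycleRange_subset_part {s : MarkedStage.{u}}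
    (hp : ∀ Q, s.P = some Q → Set.range Q.hom.base ⊆ s.L.part (Scheme.hsStratum s.W N ν) Q.lbl) :
    cycleRange N ν s ⊆ s.L.part (Scheme.hsStratum s.W N ν) (treatedLabel N ν s) := by
  rcases h : s.P with _ | Q
  · rw [cycleRange_of_none h]
  · rw [cycleRange_of_some h, treatedLabel_of_some h]
    exact hp Q h

/-! ## §4. Dictionary: for the CJS strategy the σ-rows ARE stub-4's rows -/

/-- (D) is (D)σ for every CJS strategy. [folklore] -/
theorem maxOriginMovingNondegenerate_iff_forall_cjs {p N : ℕ} :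
    MaxOriginMovingNondegenerate.{u} p N ↔ ∀ R : ∀ S : Scheme.{u}, CentreSeq S → Prop,
      OracleFunctional R → OracleAdmissible R → MaxOriginMovingNondegenerateσ (Strategy.cjs R) p N :=
  Iff.rfl

/-- (b-end) is (b-end)σ for every CJS strategy. [folklore] -/
theorem strataCycleEndBirthsSettle_iff_forall_cjs {p N : ℕ} {Q : ℕ → (ℕ → ℕ) → ∀ X : Scheme.{u}, X → Prop}
    {G : MarkedStage.{u} → Prop} :
    StrataCycleEndBirthsSettle p N Q G ↔ ∀ R : ∀ S : Scheme.{u}, CentreSeq S → Prop,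
      OracleFunctional R → OracleAdmissible R → StrataCycleEndBirthsSettleσ (Strategy.cjs R) p N Q G :=
  Iff.rfl

/-- (c-rep) is (c-rep)σ for every CJS strategy. [folklore] -/
theorem strataReplayBlowupsSettle_iff_forall_cjs {p N : ℕ} {Q : ℕ → (ℕ → ℕ) → ∀ X : Scheme.{u}, X → Prop}
    {G : MarkedStage.{u} → Prop} :
    StrataReplayBlowupsSettle p N Q G ↔ ∀ R : ∀ S : Scheme.{u}, CentreSeq S → Prop,
      OracleFunctional R → OracleAdmissible R → StrataReplayBlowupsSettleσ (Strategy.cjs R) p N Q G :=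
  Iff.rfl

/-- (c-geo) is (c-geo)σ for every CJS strategy. [folklore] -/
theorem strataLineageInCentreIO_iff_forall_cjs {p N : ℕ} {Q : ℕ → (ℕ → ℕ) → ∀ X : Scheme.{u}, X → Prop}
    {G : MarkedStage.{u} → Prop} :
    StrataLineageInCentreIO p N Q G ↔ ∀ R : ∀ S : Scheme.{u}, CentreSeq S → Prop,
      OracleFunctional R → OracleAdmissible R → StrataLineageInCentreIOσ (Strategy.cjs R) p N Q G :=
  Iff.rfl

end Summit.ResolutionOfSingularities.ResolutionOfSingularities.Theorems.SigmaMaxModificationsCorridor3.Sigma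

end
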